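import Literature.Probability.RandomPlanarGeometry.HexSAWStripWidthThreeKernel
import Literature.Probability.RandomPlanarGeometry.HexSAWStripBetaContactLLN
import Literature.Probability.RandomPlanarGeometry.HexSAWStripSurfaceMonotone
import Literature.Probability.RandomPlanarGeometry.HexSAWStripSurfaceWidthTwo
import HarnessLib

/-!
# The width-three strip at criticality: a finite second contact moment, the weak laws of the surface contacts, and the critical
# surface fugacity `y₃` as a root of an explicit cubic over `ℚ(√2)`, isolated in `(2.892, 2.893)` (module «WIDTH-THREE-CRITICAL»)

Topic `Literature/Probability/RandomPlanarGeometry` (continues «WIDTH-THREE-KERNEL» `HexSAWStripWidthThreeKernel.lean`: the level classes of `S₃`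
are singletons, serpentine families or empty; `HV.W3.kerThree`, `HV.W3.Iinf_three_eq` — `Iinf 3 y` is rational with `y`-radius `x_c^{−6}`; closes, at
`T = 3`, the hypothesis `hC2` of «CONTACT-LLN» `HexSAWStripBridgeContactLLN.lean` #750 (`HV.tendsto_contacts_deviation` — «OPEN for `T ≥ 3`» there)
and of «BETA-CONTACT-LLN» `HexSAWStripBetaContactLLN.lean` #770 (`HV.tendsto_beta_contacts_deviation`); uses «AMPLITUDE-RATIO» #633
(`HV.exists_pos_fixed_vectors_Iinf_stripYT`: positive Perron vectors of `Iinf T y_T`, every `T ≥ 2`), `HV.stripYT_succ_le` (`y_{T+1} ≤ y_T`,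
`HexSAWStripSurfaceMonotone.lean`), `HV.stripYT_two = (10 + 8√2)/7`, `HV.xc_sq_eq_half` and `HV.W2.xc_minpoly` (`2x⁴ − 4x² + 1 = 0`)).
Lane «pcv-sawmu» (CriticalPhenomena venture), a-p2 g25, HANDOFF-gen24 §Recommended 1/4 («hC2 … opens CONTACT-LLN / BETA-CONTACT-LLN
unconditional at `T = 3`»; the conjectural `y₃ = 2.8922…` and its cubic, kit `charpoly3.py`, are a-p2 g24's).  Sources of the SETTING: W. Feller I
(1968) XIII.6 (renewal second moments, Chebyshev); E. Seneta (1973) §1.4 (positive eigenvectors); H. Duminil-Copin, A. Hammond, CMP 324 (2013)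
§2.2; N. R. Beaton, M. Bousquet-Mélou, J. de Gier, H. Duminil-Copin, A. J. Guttmann, CMP 326 (2014) §3.2 and Corollary 8 (the thresholds `y_T`,
decreasing in `T`; the strip at `(x_c, y_T)`).  Nothing below is printed (in print the thresholds `y_T` of narrow strips come from transfer-matrix
eigenvalues, numerically; no closed form for the width-three threshold of this strip is known to the lane).

## What is proved (namespace `Literature.Probability.RandomPlanarGeometry.SAW.HV.W3`; `x = x_c`, `y₃ = stripYT 3`)

* `xc_pow_six_mul_stripYT_three_lt_one : x_c⁶ · y₃ < 1` (`≤ x_c⁶ y₂ = (5√2 − 6)/14`): `y₃` lies inside the disc of analyticity of the kernel.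
* `sum_topCntSq_wD_le (hy : 0 ≤ y) (hy' : x_c⁶ y < 1) (N a b) : Σ_{l ∈ HBk 3 N 1 a b} #top(l.tail)² · wD(l) ≤ 1 + y + Σ_n n² (x_c⁶ y)^n`.
* ★★ **`widthThree_summable_contactSqIrr (a b : Fin 6)` — `hC2` HOLDS AT `T = 3`** (the hat slices are pairwise disjoint pieces of
  `HBk 3 (2M+1) 1 a b`; bounded partial sums of a nonnegative series).
* ★★★★ **`widthThree_contacts_deviation : ∃ θ₃, ∀ a b ε > 0, (Σ_{bridges a→b, n_k steps, |#top/n_k − θ₃| ≥ ε} x_c^{n_k} y₃^{#top}) / D̂(k)_{ab} → 0`**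
  and ★★★★ **`widthThree_beta_contacts_deviation`** (the same for β-walks of length `2m`) — UNCONDITIONAL weak laws at width three
  (`θ₃ = ⟨ℓ, C̄_M u⟩/⟨ℓ, M̄_len u⟩` for the Perron vectors of `K₃` at `y₃`; numerically `0.3304`).
* `detPoly_mul_eq_zero_of_fixed (s y) (hu : K₃(s; y) u = u) : D(x, y, s) · u₀ = 0` with
  `D = det(1 − K₃) = 1 − 2x² − x²s² − x²y + x⁴ − 2x⁴s + x⁴s² + 2x⁴y − x⁶ − 2x⁶s² − 2x⁶y + x⁸s² + 2x⁸y − x¹⁰y` — the first row of the adjugate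
  of `1 − K₃` applied to `(1 − K₃)u = 0` (six explicit cofactors; `linear_combination`).
* ★★★ **`stripYT_three_cubic : (−2 + 7√2/4) + (6 − 35√2/8) y₃ + (969/32 − 685√2/32) y₃² + (−1323/32 + 1871√2/64) y₃³ = 0`** — THE CRITICAL
  SURFACE FUGACITY OF THE WIDTH-THREE STRIP IS ALGEBRAIC: a root of an explicit cubic over `ℚ(√2)` (numerically `y₃ = 2.892231386…`, the cubic's
  only real root in `[−50, 50]`; by the tree `1 + √2 ≤ y₃ ≤ y₂ = 3.0448…`).  Route: positive fixed vector of `K₃(s₃; y₃)`, `s₃ = x⁶y₃/(1 − x⁶y₃)` ⇒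
  `D = 0` ⇒ clear `(1 − x⁶y₃)²` ⇒ reduce modulo `2x⁴ − 4x² + 1` ⇒ substitute `x² = (2 − √2)/2` (every step a `linear_combination` with an
  explicit certificate polynomial).

* ★★★ **`stripYT_three_bounds : 2.892 < stripYT 3 ∧ stripYT 3 < 2.893`** — an ISOLATING INTERVAL: the cubic is strictly decreasing on `[0, 7/2]`
  (`cubic_sub_cubic_nonpos`: `c₂ ≥ 0 ≥ c₃` and `c₁ + 7c₂ < 0` on the window `1.414213562 < √2 < 1.414213563` of `sqrt_two_window9`), `1 ≤ y₃ ≤ y₂ < 7/2`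
  in the tree, and the cubic is `> 0` at `2.892`, `< 0` at `2.893` (`nlinarith` on the `√2` window; the coefficients nearly cancel —
  `c₃ = −1323/32 + 1871√2/64 = −7.6·10⁻⁵` — so nine decimals of `√2` are needed and suffice).

Label: LANE THEOREM (own result of lane «pcv-sawmu», a-p2 g24 conjecture / a-p2 g25 proof, 2026-08-27).  NOT claimed: `u`, `ℓ`, `θ₃`, `ν₃` in closed
form; more decimals of `y₃` (= 2.8922313867… numerically); a CLT; anything for `T ≥ 4`.
-/

noncomputable section

open Finset Filter Topology Matrix Literature.Probability.LatticeModels Literature.Probability.Percolation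

namespace Literature.Probability.RandomPlanarGeometry.SAW

namespace HV

namespace W3

/-! ### §1 The second contact moment of the critical kernel of `S₃` is finite; the weak laws of the surface contacts -/

/-- The critical surface fugacity of `S₃` lies far inside the disc of analyticity of the width-three kernel: `x_c⁶ · y₃ < 1` (indeed
`x_c⁶ y₃ ≤ x_c⁶ y₂ = (5√2 − 6)/14 = 0.0765…`, by `y₃ ≤ y₂` and the closed forms `x_c² = (2 − √2)/2`, `y₂ = (10 + 8√2)/7`).
[cite: BeatonBousquetMelouDeGierDuminilCopinGuttmann2014, §3.2 (the thresholds y_T decrease in T); lane «pcv-sawmu» a-p2 g25] -/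
theorem xc_pow_six_mul_stripYT_three_lt_one : hexCriticalFugacity ^ 6 * stripYT 3 < 1 := by
  have h32 : stripYT 3 ≤ stripYT 2 := stripYT_succ_le (T := 2) (by norm_num)
  have hx2 : hexCriticalFugacity ^ 2 = (2 - Real.sqrt 2) / 2 := xc_sq_eq_half
  have hx6 : hexCriticalFugacity ^ 6 = ((2 - Real.sqrt 2) / 2) ^ 3 := by rw [← hx2]; ring
  have hs : Real.sqrt 2 ^ 2 = 2 := Real.sq_sqrt (by norm_num)
  have hs1 : 1.41 < Real.sqrt 2 := by
    rw [show (1.41 : ℝ) = Real.sqrt (1.41 ^ 2) by rw [Real.sqrt_sq (by norm_num)]]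
    exact Real.sqrt_lt_sqrt (by norm_num) (by norm_num)
  have hs2 : Real.sqrt 2 < 1.42 := by
    rw [show (1.42 : ℝ) = Real.sqrt (1.42 ^ 2) by rw [Real.sqrt_sq (by norm_num)]]
    exact Real.sqrt_lt_sqrt (by norm_num) (by norm_num)
  have hx6pos : 0 ≤ hexCriticalFugacity ^ 6 := pow_nonneg hexCriticalFugacity_pos_lt_one.1.le _
  calc hexCriticalFugacity ^ 6 * stripYT 3 ≤ hexCriticalFugacity ^ 6 * stripYT 2 := mul_le_mul_of_nonneg_left h32 hx6pos
    _ = ((2 - Real.sqrt 2) / 2) ^ 3 * ((10 + 8 * Real.sqrt 2) / 7) := by rw [hx6, stripYT_two]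
    _ < 1 := by nlinarith

/-- The second contact moment of a level class of `S₃` is bounded uniformly in the truncation: for `0 ≤ y` with `x_c⁶y < 1` and all `N, a, b`,
`Σ_{l ∈ HBk 3 N 1 a b} #top(l.tail)² · wD(l) ≤ 1 + y + Σ_n n² (x_c⁶y)^n` (short classes: one list with `#top ≤ 1`, weight `≤ max(1, y)`;
serpentine classes: `Σ_{K} K² (x_c⁶y)^K`; the rest empty). [cite: DuminilCopinHammond2013, §2.2; lane «pcv-sawmu» a-p2 g25] -/
theorem sum_topCntSq_wD_le {y : ℝ} (hy : 0 ≤ y) (hy' : hexCriticalFugacity ^ 6 * y < 1) (N : ℕ) (a b : ℤ) :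
    ∑ l ∈ HBk 3 N 1 a b, (topCnt 3 l.tail : ℝ) ^ 2 * wD 3 y l ≤
      1 + y + ∑' n : ℕ, ((n : ℝ) ^ 2 * (hexCriticalFugacity ^ 6 * y) ^ n) := by
  set q : ℝ := hexCriticalFugacity ^ 6 * y with hq
  have hq0 : 0 ≤ q := mul_nonneg (pow_nonneg hexCriticalFugacity_pos_lt_one.1.le _) hy
  have hsum : Summable fun n : ℕ => (n : ℝ) ^ 2 * q ^ n :=
    summable_pow_mul_geometric_of_norm_lt_one 2 (by rw [Real.norm_eq_abs, abs_of_nonneg hq0]; exact hy')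
  have htsum0 : 0 ≤ ∑' n : ℕ, (n : ℝ) ^ 2 * q ^ n := tsum_nonneg fun n => mul_nonneg (sq_nonneg _) (pow_nonneg hq0 _)
  have hx1 : hexCriticalFugacity ≤ 1 := hexCriticalFugacity_pos_lt_one.2.le
  have hx0 : 0 ≤ hexCriticalFugacity := hexCriticalFugacity_pos_lt_one.1.le
  -- reduce to `N ≥ 2` by monotonicity
  have hmono : ∑ l ∈ HBk 3 N 1 a b, (topCnt 3 l.tail : ℝ) ^ 2 * wD 3 y l ≤
      ∑ l ∈ HBk 3 (max N 2) 1 a b, (topCnt 3 l.tail : ℝ) ^ 2 * wD 3 y l :=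
    Finset.sum_le_sum_of_subset_of_nonneg (HBk_mono (le_max_left N 2) 1 a b) fun l _ _ => mul_nonneg (sq_nonneg _) (wD_nonneg 3 hy l)
  refine hmono.trans ?_
  set M := max N 2 with hM
  have hM2 : 2 ≤ M := le_max_right N 2
  -- a one-list class contributes `#top² · wD ≤ 1 + y`
  have hone : ∀ L : List HV, L.length ≤ 3 → topCnt 3 L.tail ≤ 1 →
      ∑ l ∈ ({L} : Finset (List HV)), (topCnt 3 l.tail : ℝ) ^ 2 * wD 3 y l ≤ 1 + y + ∑' n : ℕ, (n : ℝ) ^ 2 * q ^ n := by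
    intro L hL ht
    rw [Finset.sum_singleton]
    have hw : wD 3 y L ≤ 1 + y := by
      rw [wD]
      have hp : hexCriticalFugacity ^ (L.length - 1) ≤ 1 := pow_le_one₀ hx0 hx1
      interval_cases h : topCnt 3 L.tail
      · rw [pow_zero, mul_one]; linarith
      · rw [pow_one]; nlinarith
    have ht' : (topCnt 3 L.tail : ℝ) ^ 2 ≤ 1 := by
      have : (topCnt 3 L.tail : ℝ) ≤ 1 := by exact_mod_cast ht
      nlinarith [Nat.cast_nonneg (α := ℝ) (topCnt 3 L.tail)]
    nlinarith [wD_nonneg 3 hy L]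
  obtain ⟨h01, h10, h23, h32, h45, h54⟩ := HBk_three_pair (by omega : 1 ≤ M)
  obtain ⟨h02, h31, h24, h53⟩ := HBk_three_triple hM2
  obtain ⟨h15, h40⟩ := HBk_three_serp M
  -- the serpentine classes contribute `Σ_{K < M/6} (K+1)² q^{K+1} ≤ Σ_n n² q^n`
  have hserp : ∀ (f : ℕ → List HV), (∀ K, (f K).length = 6 * K + 1) → (∀ K, wD 3 y (f K) = hexCriticalFugacity ^ (6 * K) * y ^ K) →
      (∀ K, topCnt 3 (f K).tail = K) →
      ∑ l ∈ (Finset.range (M / 6)).image (fun K => f (K + 1)), (topCnt 3 l.tail : ℝ) ^ 2 * wD 3 y l ≤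
        1 + y + ∑' n : ℕ, (n : ℝ) ^ 2 * q ^ n := by
    intro f hlen hw ht
    rw [Finset.sum_image (fun K _ K' _ h => by have := congrArg List.length h; rw [hlen, hlen] at this; omega)]
    have hterm : ∀ K, (topCnt 3 (f (K + 1)).tail : ℝ) ^ 2 * wD 3 y (f (K + 1)) = ((K + 1 : ℕ) : ℝ) ^ 2 * q ^ (K + 1) := fun K => by
      rw [ht, hw, hq, mul_pow, ← pow_mul]
    simp only [hterm]
    have h1 : ∑ K ∈ Finset.range (M / 6), ((K + 1 : ℕ) : ℝ) ^ 2 * q ^ (K + 1) ≤ ∑' n : ℕ, (n : ℝ) ^ 2 * q ^ n := by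
      have := (Finset.sum_range_succ_comm (fun n => (n : ℝ) ^ 2 * q ^ n) (M / 6)).symm
      calc ∑ K ∈ Finset.range (M / 6), ((K + 1 : ℕ) : ℝ) ^ 2 * q ^ (K + 1)
          ≤ ∑ n ∈ Finset.range (M / 6 + 1), (n : ℝ) ^ 2 * q ^ n := by
            rw [Finset.sum_range_succ']; simp
        _ ≤ ∑' n : ℕ, (n : ℝ) ^ 2 * q ^ n :=
            hsum.sum_le_tsum _ fun n _ => mul_nonneg (sq_nonneg _) (pow_nonneg hq0 _)
    linarith
  by_cases hab : (a = 0 ∧ b = 1) ∨ (a = 0 ∧ b = 2) ∨ (a = 1 ∧ b = 0) ∨ (a = 2 ∧ b = 3) ∨ (a = 2 ∧ b = 4) ∨ (a = 3 ∧ b = 2) ∨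
      (a = 3 ∧ b = 1) ∨ (a = 4 ∧ b = 5) ∨ (a = 5 ∧ b = 4) ∨ (a = 5 ∧ b = 3) ∨ (a = 1 ∧ b = 5) ∨ (a = 4 ∧ b = 0)
  · rcases hab with ⟨rfl, rfl⟩ | ⟨rfl, rfl⟩ | ⟨rfl, rfl⟩ | ⟨rfl, rfl⟩ | ⟨rfl, rfl⟩ | ⟨rfl, rfl⟩ | ⟨rfl, rfl⟩ | ⟨rfl, rfl⟩ |
        ⟨rfl, rfl⟩ | ⟨rfl, rfl⟩ | ⟨rfl, rfl⟩ | ⟨rfl, rfl⟩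
    · rw [h01]; exact hone _ (by simp [W2.irr01]) (by simp [W2.irr01, topCnt, bit])
    · rw [h02]; exact hone _ (by simp [W2.irr02]) (by simp [W2.irr02, topCnt, bit])
    · rw [h10]; exact hone _ (by simp [W2.irr10]) (by simp [W2.irr10, topCnt, bit])
    · rw [h23]; exact hone _ (by simp [W2.irr23]) (by simp [W2.irr23, topCnt, bit])
    · rw [h24]; exact hone _ (by simp [irr24]) (by simp [irr24, topCnt, bit])
    · rw [h32]; exact hone _ (by simp [W2.irr32]) (by simp [W2.irr32, topCnt, bit])
    · rw [h31]; exact hone _ (by simp [W2.irr31]) (by simp [W2.irr31, topCnt, bit])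
    · rw [h45]; exact hone _ (by simp [irr45]) (by simp [irr45, topCnt, bit])
    · rw [h54]; exact hone _ (by simp [irr54]) (by simp [irr54, topCnt, bit])
    · rw [h53]; exact hone _ (by simp [irr53]) (by simp [irr53, topCnt, bit])
    · rw [show ((1 : ℤ) : ℤ) = ((1 : Fin (2 * 3)) : ℕ) from rfl] at h15 ⊢
      rw [show ((5 : ℤ) : ℤ) = ((5 : Fin (2 * 3)) : ℕ) from rfl] at h15 ⊢
      rw [h15]; exact hserp serpUp length_serpUp (wD_serpUp · y) topCnt_serpUp_tail
    · rw [show ((4 : ℤ) : ℤ) = ((4 : Fin (2 * 3)) : ℕ) from rfl] at h40 ⊢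
      rw [show ((0 : ℤ) : ℤ) = ((0 : Fin (2 * 3)) : ℕ) from rfl] at h40 ⊢
      rw [h40]; exact hserp serpDn length_serpDn (wD_serpDn · y) topCnt_serpDn_tail
  · rw [HBk_three_empty hab, Finset.sum_empty]
    linarith

/-- ★★ **hC2 at `T = 3`, UNCONDITIONAL**: the second contact moment of the critical irreducible kernel of `S₃` is finite along every hat class
(the hypothesis `hC2` of «CONTACT-LLN» #750 and «BETA-CONTACT-LLN» #770) — the slices are disjoint pieces of `HBk 3 N 1 a b`, whose contact
second moment is bounded uniformly in `N` because the kernel is rational with radius `x_c^{−6} ≫ y₃`. [cite: DuminilCopinHammond2013, §2.2; BeatonBousquetMelouDeGierDuminilCopinGuttmann2014, §3.2; Feller1968, XIII.6; lane «pcv-sawmu» a-p2 g25 — own result] -/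
theorem widthThree_summable_contactSqIrr (a b : Fin (2 * 3)) :
    Summable fun k : ℕ => ∑ l ∈ LMset 3 (2 * k + 1) (hatLen k a b) (a : ℕ) (b : ℕ), (topCnt 3 l.tail : ℝ) ^ 2 * wD 3 (stripYT 3) l := by
  have hy : 0 ≤ stripYT 3 := (stripYT_pos (by norm_num)).le
  set C : ℝ := 1 + stripYT 3 + ∑' n : ℕ, ((n : ℝ) ^ 2 * (hexCriticalFugacity ^ 6 * stripYT 3) ^ n) with hC
  have hnn : ∀ k, 0 ≤ ∑ l ∈ LMset 3 (2 * k + 1) (hatLen k a b) (a : ℕ) (b : ℕ), (topCnt 3 l.tail : ℝ) ^ 2 * wD 3 (stripYT 3) l :=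
    fun k => Finset.sum_nonneg fun l _ => mul_nonneg (sq_nonneg _) (wD_nonneg 3 hy l)
  refine summable_of_sum_range_le hnn (c := C) fun M => ?_
  -- the slices `k < M` are pairwise disjoint subsets of `HBk 3 (2M+1) 1 a b`
  have hsub : ∀ k ∈ Finset.range M, LMset 3 (2 * k + 1) (hatLen k a b) (a : ℕ) (b : ℕ) ⊆ HBk 3 (2 * M + 1) 1 (a : ℕ) (b : ℕ) := by
    intro k hk l hl
    rw [Finset.mem_range] at hk
    rw [LMset, Finset.mem_filter] at hl
    exact HBk_mono (by omega) 1 _ _ hl.1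
  have hdisj : (Finset.range M : Set ℕ).PairwiseDisjoint fun k => LMset 3 (2 * k + 1) (hatLen k a b) (a : ℕ) (b : ℕ) := by
    intro k _ k' _ hkk'
    rw [Function.onFun, Finset.disjoint_left]
    intro l hl hl'
    rw [LMset, Finset.mem_filter] at hl hl'
    have := hl.2.symm.trans hl'.2
    unfold hatLen at this
    exact hkk' (by omega)
  calc ∑ k ∈ Finset.range M, ∑ l ∈ LMset 3 (2 * k + 1) (hatLen k a b) (a : ℕ) (b : ℕ), (topCnt 3 l.tail : ℝ) ^ 2 * wD 3 (stripYT 3) l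
      = ∑ l ∈ (Finset.range M).biUnion (fun k => LMset 3 (2 * k + 1) (hatLen k a b) (a : ℕ) (b : ℕ)),
          (topCnt 3 l.tail : ℝ) ^ 2 * wD 3 (stripYT 3) l := (Finset.sum_biUnion hdisj).symm
    _ ≤ ∑ l ∈ HBk 3 (2 * M + 1) 1 (a : ℕ) (b : ℕ), (topCnt 3 l.tail : ℝ) ^ 2 * wD 3 (stripYT 3) l :=
        Finset.sum_le_sum_of_subset_of_nonneg (Finset.biUnion_subset.2 hsub) fun l _ _ => mul_nonneg (sq_nonneg _) (wD_nonneg 3 hy l)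
    _ ≤ C := sum_topCntSq_wD_le hy xc_pow_six_mul_stripYT_three_lt_one _ _ _

/-- ★★★★ **WIDTH THREE: THE SURFACE CONTACTS OF A LONG CRITICAL BRIDGE CONCENTRATE AT `θ₃ · n`** — UNCONDITIONAL.  There is a constant `θ₃`
(the contact density `⟨ℓ, C̄_M u⟩/⟨ℓ, M̄_len u⟩` of «CONTACT-DENSITY-POINTWISE» #687, `u, ℓ` the Perron vectors of the rational kernel `K₃` at
`y₃`) such that for every pair of levels `a, b` of `S₃` and every `ε > 0`, along `n_k = 2k + χ_a − χ_b`: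
`(Σ_{bridges a→b with n_k steps and |#top/n_k − θ₃| ≥ ε} x_c^{n_k} y₃^{#top}) / D̂(k)_{ab} ⟶ 0`.
(The weak law of #750 with `widthThree_summable_contactSqIrr`; numerically `θ₃ = 0.3304` under a-p2 g24's cubic for `y₃ = 2.8922…`.)
[cite: Feller1968, XIII.6 (variance; Chebyshev); DuminilCopinHammond2013, §2.2; BeatonBousquetMelouDeGierDuminilCopinGuttmann2014, Corollary 8 (the strip at (x_c, y_T)); lane «pcv-sawmu» a-p2 g25 — own result, not in print] -/
theorem widthThree_contacts_deviation :
    ∃ θ : ℝ, ∀ (a b : Fin (2 * 3)) (ε : ℝ), 0 < ε →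
      Tendsto (fun k : ℕ => (∑ l ∈ (LUset 3 (2 * k + 1) (hatLen k a b) (a : ℕ) (b : ℕ)).filter (fun l =>
          ε ≤ |(topCnt 3 l.tail : ℝ) / (hatLen k a b : ℝ) - θ|), wD 3 (stripYT 3) l) / hatD 3 (stripYT 3) k a b) atTop (𝓝 0) := by
  obtain ⟨u, ℓ, hu0, hℓ0, hu, hℓ⟩ := exists_pos_fixed_vectors_Iinf_stripYT (T := 3) (by norm_num)
  exact ⟨_, fun a b ε hε => tendsto_contacts_deviation (T := 3) (by norm_num) hu0 hℓ0 hu hℓ widthThree_summable_contactSqIrr a b hε⟩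

/-- ★★★★ **WIDTH THREE, β-WALKS: THE SURFACE CONTACTS OF A LONG CRITICAL β-WALK CONCENTRATE AT `θ₃ · n`** — UNCONDITIONAL (the weak law of
«BETA-CONTACT-LLN» #770 with `widthThree_summable_contactSqIrr`; same `θ₃` as for bridges).
[cite: Feller1968, XIII.6; DuminilCopinHammond2013, §2.2; BeatonBousquetMelouDeGierDuminilCopinGuttmann2014, §3.2 and Corollary 8; lane «pcv-sawmu» a-p2 g25 — own result, not in print] -/
theorem widthThree_beta_contacts_deviation :
    ∃ θ : ℝ, ∀ ε : ℝ, 0 < ε →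
      Tendsto (fun m : ℕ => (∑ l ∈ (betaLen 3 (2 * m) (2 * m)).filter (fun l =>
          ε ≤ |(topCnt 3 l : ℝ) / (2 * (m : ℝ)) - θ|), hexCriticalFugacity ^ l.length * stripYT 3 ^ topCnt 3 l) /
        betaLenSum 3 (2 * m) (stripYT 3)) atTop (𝓝 0) := by
  obtain ⟨u, ℓ, hu0, hℓ0, hu, hℓ⟩ := exists_pos_fixed_vectors_Iinf_stripYT (T := 3) (by norm_num)
  exact ⟨_, fun ε hε => tendsto_beta_contacts_deviation (T := 3) (by norm_num) hu0 hℓ0 hu hℓ widthThree_summable_contactSqIrr hε⟩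

/-! ### §2 The critical surface fugacity `y₃` is a root of an explicit cubic over `ℚ(√2)` -/

/-- **The adjugate identity of the width-three kernel.**  For every vector `u` with `K₃(s; y) u = u`,
`D(x_c, y, s) · u₀ = 0`, where `D = det(1 − K₃(s; y)) = 1 − 2x² − x²s² − x²y + x⁴ − 2x⁴s + x⁴s² + 2x⁴y − x⁶ − 2x⁶s² − 2x⁶y + x⁸s² + 2x⁸y − x¹⁰y`
(the first row of the adjugate of `1 − K₃` applied to `(1 − K₃)u = 0`; the six cofactors are explicit polynomials, checked by `ring`).
[cite: DuminilCopinHammond2013, §2.2; Seneta1973, §1.4 (positive eigenvectors); lane «pcv-sawmu» a-p2 g25 — own computation] -/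
theorem detPoly_mul_eq_zero_of_fixed (s y : ℝ) {u : Fin (2 * 3) → ℝ} (hu : kerThree s y *ᵥ u = u) :
    (1 - 2 * hexCriticalFugacity ^ 2 - hexCriticalFugacity ^ 2 * s ^ 2 - hexCriticalFugacity ^ 2 * y + hexCriticalFugacity ^ 4
      - 2 * hexCriticalFugacity ^ 4 * s + hexCriticalFugacity ^ 4 * s ^ 2 + 2 * hexCriticalFugacity ^ 4 * y - hexCriticalFugacity ^ 6
      - 2 * hexCriticalFugacity ^ 6 * s ^ 2 - 2 * hexCriticalFugacity ^ 6 * y + hexCriticalFugacity ^ 8 * s ^ 2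
      + 2 * hexCriticalFugacity ^ 8 * y - hexCriticalFugacity ^ 10 * y) * u 0 = 0 := by
  set x : ℝ := hexCriticalFugacity with hx
  have h0 := congrFun hu 0
  have h1 := congrFun hu 1
  have h2 := congrFun hu 2
  have h3 := congrFun hu 3
  have h4 := congrFun hu 4
  have h5 := congrFun hu 5
  simp [kerThree, Matrix.mulVec, dotProduct, Fin.sum_univ_succ, ← hx] at h0 h1 h2 h3 h4 h5
  linear_combination (-(1 - x^2 - x^2*y - x^4*s + x^4*y - x^6*y)) * h0
    + (-(x - x^3 - x^3*y + x^5 + x^5*y - 2*x^7*y + x^9*y)) * h1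
    + (-(x^2 + x^4*s - x^4*y - x^6*s)) * h2
    + (-(x^3 + x^3*s - x^5*y + x^7*y)) * h3
    + (-(x^2*s + x^4 - x^4*s + 2*x^6*s - x^8*s)) * h4
    + (-(x*s - x^3*s + x^5*s + x^5*y)) * h5

/-- ★★★ **The critical surface fugacity of the width-three strip is ALGEBRAIC over `ℚ(√2)`**: `y₃ = stripYT 3` is a root of the cubic
`(−2 + 7√2/4) + (6 − 35√2/8)·y + (969/32 − 685√2/32)·y² + (−1323/32 + 1871√2/64)·y³ = 0` (numerically `y₃ = 2.89223138…`, its only real root in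
`[−50, 50]`; the tree also has `1 + √2 ≤ y₃ ≤ y₂ = (10 + 8√2)/7`).  Proof: the critical kernel `Iinf 3 y₃ = K₃(s₃; y₃)`, `s₃ = x⁶y₃/(1 − x⁶y₃)` (rational
kernel, `x_c⁶ y₃ < 1`), has a positive fixed vector (`exists_pos_fixed_vectors_Iinf_stripYT`), so the adjugate identity forces `det(1 − K₃(s₃; y₃)) = 0`;
clearing `1 − x⁶y₃` and reducing modulo `2x⁴ − 4x² + 1 = 0` (`x² = (2 − √2)/2`) leaves the cubic.  This is a-p2 g24's conjectural `y₃` (HANDOFF-gen24,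
kit `charpoly3.py`) made a theorem. [cite: BeatonBousquetMelouDeGierDuminilCopinGuttmann2014, §3.2 and Corollary 8 (the thresholds y_T); Seneta1973, §1.4; DuminilCopinHammond2013, §2.2; lane «pcv-sawmu» a-p2 g24 (conjecture) / g25 (proof) — own result, not in print] -/
theorem stripYT_three_cubic :
    (-2 + 7 / 4 * Real.sqrt 2) + (6 - 35 / 8 * Real.sqrt 2) * stripYT 3 + (969 / 32 - 685 / 32 * Real.sqrt 2) * stripYT 3 ^ 2
      + (-1323 / 32 + 1871 / 64 * Real.sqrt 2) * stripYT 3 ^ 3 = 0 := by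
  set x : ℝ := hexCriticalFugacity with hx
  set y : ℝ := stripYT 3 with hy
  have hy0 : 0 ≤ y := (stripYT_pos (by norm_num)).le
  have hq1 : x ^ 6 * y < 1 := xc_pow_six_mul_stripYT_three_lt_one
  set s : ℝ := x ^ 6 * y / (1 - x ^ 6 * y) with hs
  have hne : 1 - x ^ 6 * y ≠ 0 := by linarith
  have hs' : s * (1 - x ^ 6 * y) = x ^ 6 * y := by rw [hs, div_mul_cancel₀ _ hne]
  -- the critical kernel is `K₃(s; y)` and has a positive fixed vector
  obtain ⟨u, ℓ, hu0, -, hu, -⟩ := exists_pos_fixed_vectors_Iinf_stripYT (T := 3) (by norm_num)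
  rw [Iinf_three_eq hy0 hq1] at hu
  have hD := detPoly_mul_eq_zero_of_fixed s y hu
  have hD0 : 1 - 2 * x ^ 2 - x ^ 2 * s ^ 2 - x ^ 2 * y + x ^ 4 - 2 * x ^ 4 * s + x ^ 4 * s ^ 2 + 2 * x ^ 4 * y - x ^ 6
      - 2 * x ^ 6 * s ^ 2 - 2 * x ^ 6 * y + x ^ 8 * s ^ 2 + 2 * x ^ 8 * y - x ^ 10 * y = 0 := by
    rcases mul_eq_zero.1 hD with h | h
    · exact h
    · exact absurd h (hu0 0).ne'
  -- clear the denominator of `s`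
  have hQ : 1 + (-2) * x ^ 2 + (-1) * x ^ 2 * y + 1 * x ^ 4 + 2 * x ^ 4 * y + (-1) * x ^ 6 + (-4) * x ^ 6 * y + 6 * x ^ 8 * y + 2 * x ^ 8 * y ^ 2 + (-5) * x ^ 10 * y + (-4) * x ^ 10 * y ^ 2 + 2 * x ^ 12 * y + 5 * x ^ 12 * y ^ 2 + (-7) * x ^ 14 * y ^ 2 + (-1) * x ^ 14 * y ^ 3 + 6 * x ^ 16 * y ^ 2 + 2 * x ^ 16 * y ^ 3 + (-3) * x ^ 18 * y ^ 2 + (-2) * x ^ 18 * y ^ 3 + 1 * x ^ 20 * y ^ 2 + 2 * x ^ 20 * y ^ 3 + (-1) * x ^ 22 * y ^ 3 = 0 := by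
    linear_combination (1 - x ^ 6 * y) ^ 2 * hD0 + ((1) * x ^ 2 * s + (2) * x ^ 4 + (-1) * x ^ 4 * s + (2) * x ^ 6 * s + (-1) * x ^ 8 * s + (1) * x ^ 8 * y + (-1) * x ^ 8 * y * s + (-3) * x ^ 10 * y + (1) * x ^ 10 * y * s + (2) * x ^ 12 * y + (-2) * x ^ 12 * y * s + (-1) * x ^ 14 * y + (1) * x ^ 14 * y * s) * hs'
  -- reduce modulo the minimal polynomial of `x_c²`
  have hmin : 2 * x ^ 4 - 4 * x ^ 2 + 1 = 0 := W2.xc_minpoly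
  have hAB : ((3/2 : ℝ) + (-11/4 : ℝ) * y + (-401/32 : ℝ) * y ^ 2 + (137/8 : ℝ) * y ^ 3) + ((-7/2 : ℝ) + (35/4 : ℝ) * y + (685/16 : ℝ) * y ^ 2 + (-1871/32 : ℝ) * y ^ 3) * x ^ 2 = 0 := by
    linear_combination hQ - ((-1/2 : ℝ) + (11/4 : ℝ) * y + (401/32 : ℝ) * y ^ 2 + (-137/8 : ℝ) * y ^ 3 + (-1/2 : ℝ) * x ^ 2 + (5/4 : ℝ) * x ^ 2 * y + (117/16 : ℝ) * x ^ 2 * y ^ 2 + (-321/32 : ℝ) * x ^ 2 * y ^ 3 + (3/2 : ℝ) * x ^ 4 * y + (67/16 : ℝ) * x ^ 4 * y ^ 2 + (-47/8 : ℝ) * x ^ 4 * y ^ 3 + (-1/2 : ℝ) * x ^ 6 * y + (17/8 : ℝ) * x ^ 6 * y ^ 2 + (-55/16 : ℝ) * x ^ 6 * y ^ 3 + (1 : ℝ) * x ^ 8 * y + (17/8 : ℝ) * x ^ 8 * y ^ 2 + (-2 : ℝ) * x ^ 8 * y ^ 3 + (1/4 : ℝ) * x ^ 10 * y ^ 2 +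 (-9/8 : ℝ) * x ^ 10 * y ^ 3 + (7/4 : ℝ) * x ^ 12 * y ^ 2 + (-1/2 : ℝ) * x ^ 12 * y ^ 3 + (-1/2 : ℝ) * x ^ 14 * y ^ 2 + (-3/4 : ℝ) * x ^ 14 * y ^ 3 + (1/2 : ℝ) * x ^ 16 * y ^ 2 + (-1/2 : ℝ) * x ^ 18 * y ^ 3) * hmin
  have hx2 : x ^ 2 = (2 - Real.sqrt 2) / 2 := xc_sq_eq_half
  rw [hx2] at hAB
  linear_combination hAB

/-! ### §3 An isolating interval: `2.892 < y₃ < 2.893` -/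

/-- `√2` to nine decimals (plumbing). [cite: BeatonBousquetMelouDeGierDuminilCopinGuttmann2014, §3.2; lane plumbing] -/
theorem sqrt_two_window9 : 1.414213562 < Real.sqrt 2 ∧ Real.sqrt 2 < 1.414213563 := by
  constructor
  · rw [show (1.414213562 : ℝ) = Real.sqrt (1.414213562 ^ 2) by rw [Real.sqrt_sq (by norm_num)]]
    exact Real.sqrt_lt_sqrt (by norm_num) (by norm_num)
  · rw [show (1.414213563 : ℝ) = Real.sqrt (1.414213563 ^ 2) by rw [Real.sqrt_sq (by norm_num)]]
    exact Real.sqrt_lt_sqrt (by norm_num) (by norm_num)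

/-- The cubic of `stripYT_three_cubic` is strictly decreasing on `[0, 7]`: for `0 ≤ y, y' ≤ 7`,
`F(y) − F(y') = (y − y')·G` with `G ≤ c₁ + 7 c₂ < 0` (`c₂ ≥ 0 ≥ c₃` on the `√2` window). (plumbing for the isolating interval)
[cite: BeatonBousquetMelouDeGierDuminilCopinGuttmann2014, §3.2; lane «pcv-sawmu» a-p2 g25] -/
theorem cubic_sub_cubic_nonpos {y y' : ℝ} (hy : 0 ≤ y) (hy7 : y ≤ (7 : ℝ) / 2) (hy' : 0 ≤ y') (hy'7 : y' ≤ (7 : ℝ) / 2) (h : y' ≤ y) :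
    ((-2 + 7 / 4 * Real.sqrt 2) + (6 - 35 / 8 * Real.sqrt 2) * y + (969 / 32 - 685 / 32 * Real.sqrt 2) * y ^ 2
        + (-1323 / 32 + 1871 / 64 * Real.sqrt 2) * y ^ 3) -
      ((-2 + 7 / 4 * Real.sqrt 2) + (6 - 35 / 8 * Real.sqrt 2) * y' + (969 / 32 - 685 / 32 * Real.sqrt 2) * y' ^ 2
        + (-1323 / 32 + 1871 / 64 * Real.sqrt 2) * y' ^ 3) ≤ 0 := by
  obtain ⟨hr1, hr2⟩ := sqrt_two_window9
  set r := Real.sqrt 2 with hr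
  have hc2 : 0 ≤ 969 / 32 - 685 / 32 * r := by linarith
  have hc3 : -1323 / 32 + 1871 / 64 * r ≤ 0 := by linarith
  have hc1 : (6 - 35 / 8 * r) + (969 / 32 - 685 / 32 * r) * 7 < 0 := by linarith
  have hS1 : y + y' ≤ 7 := by linarith
  have hS2 : 0 ≤ y ^ 2 + y * y' + y' ^ 2 := by positivity
  have hfac : ((-2 + 7 / 4 * r) + (6 - 35 / 8 * r) * y + (969 / 32 - 685 / 32 * r) * y ^ 2 + (-1323 / 32 + 1871 / 64 * r) * y ^ 3) -
      ((-2 + 7 / 4 * r) + (6 - 35 / 8 * r) * y' + (969 / 32 - 685 / 32 * r) * y' ^ 2 + (-1323 / 32 + 1871 / 64 * r) * y' ^ 3) =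
      (y - y') * ((6 - 35 / 8 * r) + (969 / 32 - 685 / 32 * r) * (y + y') + (-1323 / 32 + 1871 / 64 * r) * (y ^ 2 + y * y' + y' ^ 2)) := by
    ring
  rw [hfac]
  have hG : (6 - 35 / 8 * r) + (969 / 32 - 685 / 32 * r) * (y + y') + (-1323 / 32 + 1871 / 64 * r) * (y ^ 2 + y * y' + y' ^ 2) ≤ 0 := by
    have h1 : (969 / 32 - 685 / 32 * r) * (y + y') ≤ (969 / 32 - 685 / 32 * r) * 7 := mul_le_mul_of_nonneg_left hS1 hc2
    have h2 : (-1323 / 32 + 1871 / 64 * r) * (y ^ 2 + y * y' + y' ^ 2) ≤ 0 := mul_nonpos_of_nonpos_of_nonneg hc3 hS2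
    linarith
  exact mul_nonpos_of_nonneg_of_nonpos (by linarith) hG

/-- ★★★ **An isolating interval for the critical surface fugacity of the width-three strip: `2.892 < y₃ < 2.893`** (from `stripYT_three_cubic`:
the cubic is strictly decreasing on `[0, 7/2] ∋ y₃` — `1 ≤ y₃ ≤ y₂ = 3.04…` in the tree — positive at `2.892`, negative at `2.893`).
[cite: BeatonBousquetMelouDeGierDuminilCopinGuttmann2014, §3.2 and Corollary 8 (the thresholds y_T); lane «pcv-sawmu» a-p2 g24 (numerics) / g25 (proof) — own result, not in print] -/
theorem stripYT_three_bounds : 2.892 < stripYT 3 ∧ stripYT 3 < 2.893 := by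
  obtain ⟨hr1, hr2⟩ := sqrt_two_window9
  have hF := stripYT_three_cubic
  set r := Real.sqrt 2 with hr
  set y := stripYT 3 with hy
  have hy1 : 1 ≤ y := one_le_stripYT (by norm_num)
  have hy2 : y ≤ (7 : ℝ) / 2 := by
    have h32 : stripYT 3 ≤ stripYT 2 := stripYT_succ_le (T := 2) (by norm_num)
    rw [stripYT_two] at h32
    rw [hy]; nlinarith
  -- the cubic at the two endpoints: `F(2.892) > 0`, `F(2.893) < 0`
  have hlo : 0 < (-2 + 7 / 4 * r) + (6 - 35 / 8 * r) * 2.892 + (969 / 32 - 685 / 32 * r) * 2.892 ^ 2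
      + (-1323 / 32 + 1871 / 64 * r) * 2.892 ^ 3 := by nlinarith
  have hhi : (-2 + 7 / 4 * r) + (6 - 35 / 8 * r) * 2.893 + (969 / 32 - 685 / 32 * r) * 2.893 ^ 2
      + (-1323 / 32 + 1871 / 64 * r) * 2.893 ^ 3 < 0 := by nlinarith
  constructor
  · by_contra hle
    rw [not_lt] at hle
    have := cubic_sub_cubic_nonpos (y := 2.892) (y' := y) (by norm_num) (by norm_num) (by linarith) hy2 hle
    linarith
  · by_contra hle
    rw [not_lt] at hle
    have := cubic_sub_cubic_nonpos (y := y) (y' := 2.893) (by linarith) hy2 (by norm_num) (by norm_num) hle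
    linarith

end W3

end HV

end Literature.Probability.RandomPlanarGeometry.SAW
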